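import Summits.Ventures.LatticeQCDFlow.Scaling.SimulatedTemperingLevelKernelBalance
import Summits.Ventures.LatticeQCDFlow.Scaling.SimulatedTemperingWithinLevel
import Summits.Ventures.LatticeQCDFlow.Scaling.SimulatedTemperingComposition
import Summits.Ventures.LatticeQCDFlow.Scaling.TemperingLevelTauInt

/-!
HONEST FRAMING: exact (Metropolis-corrected) sampling algorithms for lattice gauge theory; figures
of merit are autocorrelation/cost numbers at stated couplings and volumes; no continuum-physics
claim.

# SimulatedTemperingAlgorithm — THE SIMULATED-TEMPERING SAMPLER ITSELF (EXACT-WEIGHT METROPOLIS LEVEL MOVE +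
# ANY EXACT WITHIN-LEVEL UPDATES, IN DETERMINISTIC OR RANDOM SCAN) IS A MARKOV KERNEL SATISFYING (i)–(iii), SO
# ITS LEVEL IS DIFFUSIVE: `ρ_lev(1) ≥ 1 − 6ā_K/(K(K+2))`, LADDER-SIZE-FREE `≥ 1 − 96/(e·m·(b−a)²)`, AND — IN
# RANDOM SCAN WITH REVERSIBLE WITHIN-LEVEL UPDATES — `τ_int(level) ≥ e·m·(b−a)²/96 − ½` (lean-2 GEN-14, ours)

Venture-side (OURS).  Cell `lqcd-flow` (pub-lqcd), unit `pub-lqcd-lean-2-g14`, 2026-08-24.  GEN-13's laws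
(`Scaling/SimulatedTemperingDiffusive`, `…Composition`, `Scaling/TemperingLevelTauInt`) quantify over all Markov
kernels with (i) the exact-weight target `stTarget X μ β K` invariant, (ii) nearest-neighbour level moves,
(iii) level-move probabilities at most the exact Metropolis ratios.  GEN-14 CONSTRUCTED the two ingredients of
the algorithm — the exact-weight Metropolis level kernel `L = stLevelKernel hXm μ β K`
(`Scaling/SimulatedTemperingLevelKernel{,Balance}`: Markov, (ii), (iii) with equality `u = ½·min(1,p_{k+1}/p_k)`,
DETAILED BALANCE) and the within-level sweep `W = stWithinLevel M` of any family `M k` of `μ_{β_k}`-invariant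
Markov kernels on `Ω` (`Scaling/SimulatedTemperingWithinLevel`: Markov, level-preserving, `stTarget`-invariant,
reversible when the `M k` are) — and the random-scan mixture `mixtureKernel t`.  This file ASSEMBLES them: the
deterministic-scan sampler `W ∘ₖ L` ("move the level, then update the configuration at the new coupling"),
the reversed scan `L ∘ₖ W`, and the random-scan sampler `t·L + (1−t)·W` satisfy (i)–(iii), hence every GEN-13
law — now theorems about NAMED KERNELS with no hypothesis left except that the within-level updates are exact
(and, for `τ_int`, reversible, plus the summability / `ρ(1) < 1` provisos of row 8's Madras–Slade floor).

## What is proved (`μ` probability, `X` bounded measurable, `M : Fin (K+1) → Kernel Ω Ω` Markov with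
## `μ_{β_k} = μ.tilted(β_k·X)` invariant under `M k`; `ā_K = (2/(K+1))·Σ_{k<K} ∫ min(p_{β_k}, p_{β_{k+1}}) dμ`)

* §1 deterministic scan `W ∘ₖ L`: `stScan_invariant`, `stScan_nearestNeighbour`, `stScan_real_up_le`,
  `stScan_real_down_le` ((i)–(iii)); **`stScan_level_lagOneAutocorr_ge`** — `1 − 6ā_K/(K(K+2)) ≤ ρ_lev(1)`
  (`K ≥ 1`); **`stScan_level_lagOneAutocorr_ge_before`** — the same for `L ∘ₖ W`;
  **`stScan_level_lagOneAutocorr_ge_kfree`** — uniform ladder on `[a,b]`, variance floor `m`: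
  `1 − 96/(e·m·(b−a)²) ≤ ρ_lev(1)` for every `K`.
* §2 random scan `t·L + (1−t)·W` (`t ∈ [0,1]`): `stMix_invariant`, `stMix_nearestNeighbour`, `stMix_real_up_le`,
  `stMix_real_down_le`, `stMix_rate_le` (`P(level moves) ≤ t·(u+d) ≤ stLevelMoveRatio`), `stMix_isReversible`
  (every `M k` reversible for `μ_{β_k}`); **`stMix_level_lagOneAutocorr_ge`**, **`stMix_level_lagOneAutocorr_ge_kfree`**;
  **`stMix_level_tauInt_ge`** — `K(K+2)/(6ā_K) − ½ ≤ τ_int(level)` and **`stMix_level_tauInt_ge_kfree`** —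
  `e·m·(b−a)²/96 − ½ ≤ τ_int(level)` for every `K ≥ 1` (reversible `M k`; summable autocorrelations, `ρ(1) < 1`).

Reading (no numerics implied): the textbook simulated-tempering sampler across a coupling window — whatever
exact algorithm updates the gauge field between level moves, however many levels — refreshes its coupling no
faster than a random walk needing `Ω(m·(b−a)²)` steps per decorrelation, `m` the smallest heat capacity on the
window.  NOT CLAIMED: irreducibility / convergence (depends on the `M k`); the summability provisos of the
`τ_int` floor; deterministic-scan `τ_int` (`W ∘ₖ L` is not reversible); non-uniform ladders in the `K`-free form;
estimated weights; any measured number.  Literature grade (cell rule): TEXTBOOK ALGORITHM (Marinari–Parisi 1992;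
Geyer–Thompson 1995) + KNOWN MECHANISM (Katzgraber–Trebst–Huse–Troyer 2006; Woodard–Schmidler–Huber 2009), NEW
TYPING (named Mathlib kernels); nothing cited as a fact.  The Wilson coupling family of every compact gauge group
(and the realistic two-dimensional / strong-coupling constants) is docked in the companion
`Scaling/SimulatedTemperingAlgorithmWilson`.
-/

noncomputable section

open MeasureTheory ProbabilityTheory Set Filter Finset
open Summit.Ventures.LatticeQCDFlow.Scoring
open scoped ENNReal

namespace Summit.Ventures.LatticeQCDFlow.Scaling

/-! ## §1 Deterministic scan: level move, then within-level sweep (and the reversed order) -/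

section Scan

variable {Ω : Type*} [MeasurableSpace Ω] {X : Ω → ℝ} {μ : Measure Ω} [IsProbabilityMeasure μ]
  {β : ℕ → ℝ} {K : ℕ}

/-- (i) for the deterministic-scan sampler `W ∘ₖ L`: the exact-weight target is invariant. [ours] -/
theorem stScan_invariant (hXm : Measurable X) (hXb : ∃ C, ∀ x, |X x| ≤ C) (M : Fin (K + 1) → Kernel Ω Ω)
    (hM : ∀ k : Fin (K + 1), Kernel.Invariant (M k) (μ.tilted fun x => β k * X x)) :
    Kernel.Invariant (stWithinLevel M ∘ₖ stLevelKernel hXm μ β K) (stTarget X μ β K) :=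
  (invariant_stWithinLevel M hM).comp (invariant_stLevelKernel hXm hXb)

omit [IsProbabilityMeasure μ] in
/-- (ii) for `W ∘ₖ L`: the level moves by at most one rung. [ours] -/
theorem stScan_nearestNeighbour (hXm : Measurable X) (M : Fin (K + 1) → Kernel Ω Ω) [∀ k, IsMarkovKernel (M k)]
    (z : Fin (K + 1) × Ω) :
    ∀ᵐ y ∂((stWithinLevel M ∘ₖ stLevelKernel hXm μ β K) z),
      |(((y.1 : Fin (K + 1)) : ℕ) : ℝ) - ((z.1 : Fin (K + 1)) : ℕ)| ≤ 1 :=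
  comp_nearestNeighbour (M := stWithinLevel M) (κ₁ := stLevelKernel hXm μ β K) measurable_stLevel
    (stWithinLevel_levelPreserving M) (stLevelKernel_nearestNeighbour hXm) z

omit [IsProbabilityMeasure μ] in
/-- (iii, up) for `W ∘ₖ L`: the up-move probability is `u(k,x) ≤ min(1, p_{β_{k+1}}(x)/p_{β_k}(x))`. [ours] -/
theorem stScan_real_up_le (hXm : Measurable X) (M : Fin (K + 1) → Kernel Ω Ω) [∀ k, IsMarkovKernel (M k)]
    (k : Fin (K + 1)) (x : Ω) (hk : (k : ℕ) < K) :
    ((stWithinLevel M ∘ₖ stLevelKernel hXm μ β K) (k, x)).real {y | ((y.1 : Fin (K + 1)) : ℕ) = (k : ℕ) + 1} ≤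
      min 1 ((Real.exp (β ((k : ℕ) + 1) * X x) / mgf X μ (β ((k : ℕ) + 1))) /
        (Real.exp (β (k : ℕ) * X x) / mgf X μ (β (k : ℕ)))) := by
  have e : {y : Fin (K + 1) × Ω | ((y.1 : Fin (K + 1)) : ℕ) = (k : ℕ) + 1} =
      (fun z : Fin (K + 1) × Ω => ((z.1 : Fin (K + 1)) : ℕ)) ⁻¹' {(k : ℕ) + 1} := by
    ext y; simp
  rw [e, comp_real_levelSet (M := stWithinLevel M) (κ₁ := stLevelKernel hXm μ β K) measurable_stLevel
    (stWithinLevel_levelPreserving M), ← e]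
  exact stLevelKernel_hup hXm k x hk

omit [IsProbabilityMeasure μ] in
/-- (iii, down) for `W ∘ₖ L`: the down-move probability is `d(k,x) ≤ min(1, p_{β_{k−1}}(x)/p_{β_k}(x))`. [ours] -/
theorem stScan_real_down_le (hXm : Measurable X) (M : Fin (K + 1) → Kernel Ω Ω) [∀ k, IsMarkovKernel (M k)]
    (k : Fin (K + 1)) (x : Ω) (hk : 1 ≤ (k : ℕ)) :
    ((stWithinLevel M ∘ₖ stLevelKernel hXm μ β K) (k, x)).real {y | ((y.1 : Fin (K + 1)) : ℕ) + 1 = (k : ℕ)} ≤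
      min 1 ((Real.exp (β ((k : ℕ) - 1) * X x) / mgf X μ (β ((k : ℕ) - 1))) /
        (Real.exp (β (k : ℕ) * X x) / mgf X μ (β (k : ℕ)))) := by
  have e : {y : Fin (K + 1) × Ω | ((y.1 : Fin (K + 1)) : ℕ) + 1 = (k : ℕ)} =
      (fun z : Fin (K + 1) × Ω => ((z.1 : Fin (K + 1)) : ℕ)) ⁻¹' {n : ℕ | n + 1 = (k : ℕ)} := by
    ext y; simp
  rw [e, comp_real_levelSet (M := stWithinLevel M) (κ₁ := stLevelKernel hXm μ β K) measurable_stLevel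
    (stWithinLevel_levelPreserving M), ← e]
  exact stLevelKernel_hdown hXm k x hk

/-- **THE LEVEL OF THE SIMULATED-TEMPERING SAMPLER IS DIFFUSIVE (deterministic scan).**  `μ` a probability
measure, `X` bounded measurable, levels `β_0, …, β_K` (`K ≥ 1`), `M k` ANY Markov kernels on `Ω` leaving
`μ_{β_k}` invariant.  The sampler "exact-weight Metropolis level move, then update the configuration by `M` at the
current level" — the kernel `stWithinLevel M ∘ₖ stLevelKernel hXm μ β K` — has stationary lag-one level
autocorrelation `ρ_lev(1) ≥ 1 − 6ā_K/(K(K+2))`. [ours] -/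
theorem stScan_level_lagOneAutocorr_ge (hXm : Measurable X) (hXb : ∃ C, ∀ x, |X x| ≤ C) (hK : 1 ≤ K)
    (M : Fin (K + 1) → Kernel Ω Ω) [∀ k, IsMarkovKernel (M k)]
    (hM : ∀ k : Fin (K + 1), Kernel.Invariant (M k) (μ.tilted fun x => β k * X x)) :
    1 - 6 * (2 / (K + 1) * ∑ k ∈ range K, ∫ x, min (Real.exp (β k * X x) / mgf X μ (β k))
        (Real.exp (β (k + 1) * X x) / mgf X μ (β (k + 1))) ∂μ) / (K * (K + 2)) ≤
      (autocov (stWithinLevel M ∘ₖ stLevelKernel hXm μ β K) (stTarget X μ β K)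
          (fun z => (((z.1 : Fin (K + 1)) : ℕ) : ℝ)) 1 - ((K : ℝ) / 2) ^ 2) / (K * (K + 2) / 12) :=
  st_level_lagOneAutocorr_ge_comp hXm hXb hK (stLevelKernel hXm μ β K) (stWithinLevel M)
    (invariant_stLevelKernel hXm hXb) (invariant_stWithinLevel M hM) (stWithinLevel_levelPreserving M)
    (stLevelKernel_nearestNeighbour hXm) (stLevelKernel_hup hXm) (stLevelKernel_hdown hXm)

/-- **The reversed scan** "update the configuration at the current level, then move the level" — the kernel
`stLevelKernel hXm μ β K ∘ₖ stWithinLevel M` — has the same lag-one level autocovariance, hence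
`ρ_lev(1) ≥ 1 − 6ā_K/(K(K+2))` as well. [ours] -/
theorem stScan_level_lagOneAutocorr_ge_before (hXm : Measurable X) (hXb : ∃ C, ∀ x, |X x| ≤ C) (hK : 1 ≤ K)
    (M : Fin (K + 1) → Kernel Ω Ω) [∀ k, IsMarkovKernel (M k)]
    (hM : ∀ k : Fin (K + 1), Kernel.Invariant (M k) (μ.tilted fun x => β k * X x)) :
    1 - 6 * (2 / (K + 1) * ∑ k ∈ range K, ∫ x, min (Real.exp (β k * X x) / mgf X μ (β k))
        (Real.exp (β (k + 1) * X x) / mgf X μ (β (k + 1))) ∂μ) / (K * (K + 2)) ≤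
      (autocov (stLevelKernel hXm μ β K ∘ₖ stWithinLevel M) (stTarget X μ β K)
          (fun z => (((z.1 : Fin (K + 1)) : ℕ) : ℝ)) 1 - ((K : ℝ) / 2) ^ 2) / (K * (K + 2) / 12) :=
  st_level_lagOneAutocorr_ge_comp_before hXm hXb hK (stLevelKernel hXm μ β K) (stWithinLevel M)
    (invariant_stLevelKernel hXm hXb) (invariant_stWithinLevel M hM) (stWithinLevel_levelPreserving M)
    (stLevelKernel_nearestNeighbour hXm) (stLevelKernel_hup hXm) (stLevelKernel_hdown hXm)

/-- **THE LADDER-SIZE-FREE LAW FOR THE SAMPLER (deterministic scan).**  Uniform ladder `β_k = a + k(b−a)/K`,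
`a < b`, `K ≥ 1`, variance floor `0 < m ≤ Var_{μ_u}(X)` on `[a, b]`, `M k` any `μ_{β_k}`-invariant Markov kernels:
`1 − 96/(e·m·(b−a)²) ≤ ρ_lev(1)` for `stWithinLevel M ∘ₖ stLevelKernel`, WHATEVER `K`. [ours] -/
theorem stScan_level_lagOneAutocorr_ge_kfree (hXm : Measurable X) (hXb : ∃ C, ∀ x, |X x| ≤ C) {a b m : ℝ}
    (hab : a < b) (hm0 : 0 < m) (hm : ∀ u ∈ Icc a b, m ≤ variance X (μ.tilted fun x => u * X x)) (hK : 1 ≤ K)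
    (M : Fin (K + 1) → Kernel Ω Ω) [∀ k, IsMarkovKernel (M k)]
    (hM : ∀ k : Fin (K + 1), Kernel.Invariant (M k) (μ.tilted fun x => (a + k * ((b - a) / K)) * X x)) :
    1 - 96 / (Real.exp 1 * m * (b - a) ^ 2) ≤
      (autocov (stWithinLevel M ∘ₖ stLevelKernel hXm μ (fun k => a + k * ((b - a) / K)) K)
          (stTarget X μ (fun k => a + k * ((b - a) / K)) K)
          (fun z => (((z.1 : Fin (K + 1)) : ℕ) : ℝ)) 1 - ((K : ℝ) / 2) ^ 2) / (K * (K + 2) / 12) :=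
  st_level_lagOneAutocorr_ge_kfree hXm hXb hab hm0 hm hK _
    (stScan_invariant (β := fun k => a + k * ((b - a) / K)) hXm hXb M hM) (stScan_nearestNeighbour hXm M)
    (fun k x hk => by simpa [Nat.cast_add, Nat.cast_one] using
      stScan_real_up_le (β := fun k => a + k * ((b - a) / K)) hXm M k x hk)
    (fun k x hk => by simpa using stScan_real_down_le (β := fun k => a + k * ((b - a) / K)) hXm M k x hk)

end Scan

/-! ## §2 Random scan: with probability `t` move the level, else sweep -/

section Mix

variable {Ω : Type*} [MeasurableSpace Ω] {X : Ω → ℝ} {μ : Measure Ω} [IsProbabilityMeasure μ]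
  {β : ℕ → ℝ} {K : ℕ}

/-- (i) for the random-scan sampler `t·L + (1−t)·W`. [ours] -/
theorem stMix_invariant (hXm : Measurable X) (hXb : ∃ C, ∀ x, |X x| ≤ C) (t : unitInterval)
    (M : Fin (K + 1) → Kernel Ω Ω) (hM : ∀ k : Fin (K + 1), Kernel.Invariant (M k) (μ.tilted fun x => β k * X x)) :
    Kernel.Invariant (mixtureKernel t (stLevelKernel hXm μ β K) (stWithinLevel M)) (stTarget X μ β K) :=
  invariant_mixtureKernel t (invariant_stLevelKernel hXm hXb) (invariant_stWithinLevel M hM)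

omit [IsProbabilityMeasure μ] in
/-- (ii) for `t·L + (1−t)·W`. [ours] -/
theorem stMix_nearestNeighbour (hXm : Measurable X) (t : unitInterval) (M : Fin (K + 1) → Kernel Ω Ω)
    (z : Fin (K + 1) × Ω) :
    ∀ᵐ y ∂(mixtureKernel t (stLevelKernel hXm μ β K) (stWithinLevel M) z),
      |(((y.1 : Fin (K + 1)) : ℕ) : ℝ) - ((z.1 : Fin (K + 1)) : ℕ)| ≤ 1 := by
  rw [ae_iff]
  refine mixtureKernel_null t _ _ z (ae_iff.1 (stLevelKernel_nearestNeighbour hXm z)) ?_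
  refine measure_mono_null (fun y hy => ?_) (stWithinLevel_levelPreserving M z)
  intro h
  apply hy
  show |(((y.1 : Fin (K + 1)) : ℕ) : ℝ) - ((z.1 : Fin (K + 1)) : ℕ)| ≤ 1
  rw [h, sub_self, abs_zero]; exact zero_le_one

omit [IsProbabilityMeasure μ] in
/-- (iii, up) for `t·L + (1−t)·W`: the up-move probability is `t·u(k,x) ≤ min(1, p_{β_{k+1}}/p_{β_k})`. [ours] -/
theorem stMix_real_up_le (hXm : Measurable X) (t : unitInterval) (M : Fin (K + 1) → Kernel Ω Ω)
    [∀ k, IsMarkovKernel (M k)] (k : Fin (K + 1)) (x : Ω) (hk : (k : ℕ) < K) :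
    (mixtureKernel t (stLevelKernel hXm μ β K) (stWithinLevel M) (k, x)).real
        {y | ((y.1 : Fin (K + 1)) : ℕ) = (k : ℕ) + 1} ≤
      min 1 ((Real.exp (β ((k : ℕ) + 1) * X x) / mgf X μ (β ((k : ℕ) + 1))) /
        (Real.exp (β (k : ℕ) * X x) / mgf X μ (β (k : ℕ)))) := by
  rw [mixtureKernel_real, stLevelKernel_real_up hXm k x hk]
  have hW : (stWithinLevel M (k, x)).real {y | ((y.1 : Fin (K + 1)) : ℕ) = (k : ℕ) + 1} = 0 := by
    have hsub : {y : Fin (K + 1) × Ω | ((y.1 : Fin (K + 1)) : ℕ) = (k : ℕ) + 1} ⊆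
        {y' | ((y'.1 : Fin (K + 1)) : ℕ) ≠ (((k, x) : Fin (K + 1) × Ω).1 : ℕ)} := by
      intro y hy
      simp only [Set.mem_setOf_eq] at hy ⊢
      omega
    rw [measureReal_def, measure_mono_null hsub (stWithinLevel_levelPreserving M (k, x)), ENNReal.toReal_zero]
  rw [hW, mul_zero, add_zero]
  calc (t : ℝ) * stUpProb X μ β K (k, x) ≤ 1 * stUpProb X μ β K (k, x) :=
        mul_le_mul_of_nonneg_right t.2.2 (stUpProb_nonneg _)
    _ ≤ _ := by rw [one_mul]; exact stUpProb_le_ratio k x hk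

omit [IsProbabilityMeasure μ] in
/-- (iii, down) for `t·L + (1−t)·W`: the down-move probability is `t·d(k,x) ≤ min(1, p_{β_{k−1}}/p_{β_k})`. [ours] -/
theorem stMix_real_down_le (hXm : Measurable X) (t : unitInterval) (M : Fin (K + 1) → Kernel Ω Ω)
    [∀ k, IsMarkovKernel (M k)] (k : Fin (K + 1)) (x : Ω) (hk : 1 ≤ (k : ℕ)) :
    (mixtureKernel t (stLevelKernel hXm μ β K) (stWithinLevel M) (k, x)).real
        {y | ((y.1 : Fin (K + 1)) : ℕ) + 1 = (k : ℕ)} ≤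
      min 1 ((Real.exp (β ((k : ℕ) - 1) * X x) / mgf X μ (β ((k : ℕ) - 1))) /
        (Real.exp (β (k : ℕ) * X x) / mgf X μ (β (k : ℕ)))) := by
  rw [mixtureKernel_real, stLevelKernel_real_down hXm k x hk]
  have hW : (stWithinLevel M (k, x)).real {y | ((y.1 : Fin (K + 1)) : ℕ) + 1 = (k : ℕ)} = 0 := by
    have hsub : {y : Fin (K + 1) × Ω | ((y.1 : Fin (K + 1)) : ℕ) + 1 = (k : ℕ)} ⊆
        {y' | ((y'.1 : Fin (K + 1)) : ℕ) ≠ (((k, x) : Fin (K + 1) × Ω).1 : ℕ)} := by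
      intro y hy
      simp only [Set.mem_setOf_eq] at hy ⊢
      omega
    rw [measureReal_def, measure_mono_null hsub (stWithinLevel_levelPreserving M (k, x)), ENNReal.toReal_zero]
  rw [hW, mul_zero, add_zero]
  calc (t : ℝ) * stDownProb X μ β K (k, x) ≤ 1 * stDownProb X μ β K (k, x) :=
        mul_le_mul_of_nonneg_right t.2.2 (stDownProb_nonneg _)
    _ ≤ _ := by rw [one_mul]; exact stDownProb_le_ratio k x hk

omit [IsProbabilityMeasure μ] in
/-- The probability that `t·L + (1−t)·W` moves the level at all is `≤ stLevelMoveRatio` (in fact `≤ t·(u+d)`) —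
the rate hypothesis of the `τ_int` floor `st_level_tauInt_ge`. [ours] -/
theorem stMix_rate_le (hXm : Measurable X) (t : unitInterval) (M : Fin (K + 1) → Kernel Ω Ω)
    [∀ k, IsMarkovKernel (M k)] (z : Fin (K + 1) × Ω) :
    (mixtureKernel t (stLevelKernel hXm μ β K) (stWithinLevel M) z).real
        {y | ((y.1 : Fin (K + 1)) : ℕ) ≠ ((z.1 : Fin (K + 1)) : ℕ)} ≤ stLevelMoveRatio X μ β K z := by
  set S : Set (Fin (K + 1) × Ω) := {y | ((y.1 : Fin (K + 1)) : ℕ) ≠ ((z.1 : Fin (K + 1)) : ℕ)} with hS_def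
  have e : S = (fun y : Fin (K + 1) × Ω => ((y.1 : Fin (K + 1)) : ℕ)) ⁻¹' {n : ℕ | n ≠ ((z.1 : Fin (K + 1)) : ℕ)} := by
    ext y; simp [hS_def]
  have hS : MeasurableSet S := by rw [e]; exact measurable_stLevel MeasurableSet.of_discrete
  rw [mixtureKernel_real]
  have hW : (stWithinLevel M z).real S = 0 := by
    rw [measureReal_def, stWithinLevel_levelPreserving M z, ENNReal.toReal_zero]
  rw [hW, mul_zero, add_zero]
  -- the level kernel moves the level with probability `≤ u + d`
  have hL : (stLevelKernel hXm μ β K z).real S ≤ stUpProb X μ β K z + stDownProb X μ β K z := by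
    rw [measureReal_def, stLevelKernel_apply' hXm z hS]
    have h3 : z ∉ S := by simp [hS_def]
    rw [Set.indicator_of_notMem h3, mul_zero, add_zero]
    have i1 : S.indicator (1 : Fin (K + 1) × Ω → ℝ≥0∞) ((levUp K z.1, z.2) : Fin (K + 1) × Ω) ≤ 1 := by
      by_cases h : ((levUp K z.1, z.2) : Fin (K + 1) × Ω) ∈ S
      · rw [Set.indicator_of_mem h]; exact le_rfl
      · rw [Set.indicator_of_notMem h]; exact zero_le_one
    have i2 : S.indicator (1 : Fin (K + 1) × Ω → ℝ≥0∞) ((levDown K z.1, z.2) : Fin (K + 1) × Ω) ≤ 1 := by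
      by_cases h : ((levDown K z.1, z.2) : Fin (K + 1) × Ω) ∈ S
      · rw [Set.indicator_of_mem h]; exact le_rfl
      · rw [Set.indicator_of_notMem h]; exact zero_le_one
    calc (ENNReal.ofReal (stUpProb X μ β K z) * S.indicator 1 ((levUp K z.1, z.2) : Fin (K + 1) × Ω) +
          ENNReal.ofReal (stDownProb X μ β K z) * S.indicator 1 ((levDown K z.1, z.2) : Fin (K + 1) × Ω)).toReal
        ≤ (ENNReal.ofReal (stUpProb X μ β K z) * 1 + ENNReal.ofReal (stDownProb X μ β K z) * 1).toReal := by
          apply ENNReal.toReal_mono (by simp)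
          gcongr
      _ = stUpProb X μ β K z + stDownProb X μ β K z := by
          rw [mul_one, mul_one, ENNReal.toReal_add ENNReal.ofReal_ne_top ENNReal.ofReal_ne_top,
            ENNReal.toReal_ofReal (stUpProb_nonneg z), ENNReal.toReal_ofReal (stDownProb_nonneg z)]
  have hud : 0 ≤ stUpProb X μ β K z + stDownProb X μ β K z := add_nonneg (stUpProb_nonneg z) (stDownProb_nonneg z)
  calc (t : ℝ) * (stLevelKernel hXm μ β K z).real S ≤ 1 * (stUpProb X μ β K z + stDownProb X μ β K z) :=
        mul_le_mul t.2.2 hL measureReal_nonneg zero_le_one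
    _ ≤ stLevelMoveRatio X μ β K z := by
        rw [one_mul, ← two_mul_stUpProb_add_stDownProb]; linarith

/-- **DETAILED BALANCE OF THE RANDOM-SCAN SAMPLER**: if every `M k` is `μ_{β_k}`-reversible then `t·L + (1−t)·W` is
reversible for the exact-weight target. [ours] -/
theorem stMix_isReversible (hXm : Measurable X) (hXb : ∃ C, ∀ x, |X x| ≤ C) (t : unitInterval)
    (M : Fin (K + 1) → Kernel Ω Ω) (hM : ∀ k : Fin (K + 1), Kernel.IsReversible (M k) (μ.tilted fun x => β k * X x)) :
    Kernel.IsReversible (mixtureKernel t (stLevelKernel hXm μ β K) (stWithinLevel M)) (stTarget X μ β K) :=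
  isReversible_mixtureKernel t (isReversible_stLevelKernel hXm hXb) (isReversible_stWithinLevel M hM)

/-- **THE LEVEL OF THE RANDOM-SCAN SAMPLER IS DIFFUSIVE**: `ρ_lev(1) ≥ 1 − 6ā_K/(K(K+2))` for
`t·stLevelKernel + (1−t)·stWithinLevel M`, `M k` any `μ_{β_k}`-invariant Markov kernels, `K ≥ 1`. [ours] -/
theorem stMix_level_lagOneAutocorr_ge (hXm : Measurable X) (hXb : ∃ C, ∀ x, |X x| ≤ C) (hK : 1 ≤ K)
    (t : unitInterval) (M : Fin (K + 1) → Kernel Ω Ω) [∀ k, IsMarkovKernel (M k)]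
    (hM : ∀ k : Fin (K + 1), Kernel.Invariant (M k) (μ.tilted fun x => β k * X x)) :
    1 - 6 * (2 / (K + 1) * ∑ k ∈ range K, ∫ x, min (Real.exp (β (k : ℕ) * X x) / mgf X μ (β (k : ℕ)))
        (Real.exp (β ((k : ℕ) + 1) * X x) / mgf X μ (β ((k : ℕ) + 1))) ∂μ) / (K * (K + 2)) ≤
      (autocov (mixtureKernel t (stLevelKernel hXm μ β K) (stWithinLevel M)) (stTarget X μ β K)
          (fun z => (((z.1 : Fin (K + 1)) : ℕ) : ℝ)) 1 - ((K : ℝ) / 2) ^ 2) / (K * (K + 2) / 12) :=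
  st_level_lagOneAutocorr_ge hXm hXb hK _ (stMix_invariant hXm hXb t M hM) (stMix_nearestNeighbour hXm t M)
    (stMix_real_up_le hXm t M) (stMix_real_down_le hXm t M)

/-- **LADDER-SIZE-FREE, random scan**: uniform ladder on `[a,b]`, variance floor `m`:
`1 − 96/(e·m·(b−a)²) ≤ ρ_lev(1)` for every `K ≥ 1` and every `t`. [ours] -/
theorem stMix_level_lagOneAutocorr_ge_kfree (hXm : Measurable X) (hXb : ∃ C, ∀ x, |X x| ≤ C) {a b m : ℝ}
    (hab : a < b) (hm0 : 0 < m) (hm : ∀ u ∈ Icc a b, m ≤ variance X (μ.tilted fun x => u * X x)) (hK : 1 ≤ K)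
    (t : unitInterval) (M : Fin (K + 1) → Kernel Ω Ω) [∀ k, IsMarkovKernel (M k)]
    (hM : ∀ k : Fin (K + 1), Kernel.Invariant (M k) (μ.tilted fun x => (a + k * ((b - a) / K)) * X x)) :
    1 - 96 / (Real.exp 1 * m * (b - a) ^ 2) ≤
      (autocov (mixtureKernel t (stLevelKernel hXm μ (fun k => a + k * ((b - a) / K)) K) (stWithinLevel M))
          (stTarget X μ (fun k => a + k * ((b - a) / K)) K)
          (fun z => (((z.1 : Fin (K + 1)) : ℕ) : ℝ)) 1 - ((K : ℝ) / 2) ^ 2) / (K * (K + 2) / 12) :=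
  st_level_lagOneAutocorr_ge_kfree hXm hXb hab hm0 hm hK _
    (stMix_invariant (β := fun k => a + k * ((b - a) / K)) hXm hXb t M hM) (stMix_nearestNeighbour hXm t M)
    (fun k x hk => by simpa [Nat.cast_add, Nat.cast_one] using
      stMix_real_up_le (β := fun k => a + k * ((b - a) / K)) hXm t M k x hk)
    (fun k x hk => by simpa using stMix_real_down_le (β := fun k => a + k * ((b - a) / K)) hXm t M k x hk)

/-- **`τ_int` OF THE LEVEL OF THE RANDOM-SCAN SAMPLER WITH REVERSIBLE WITHIN-LEVEL UPDATES**: every `M k`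
`μ_{β_k}`-reversible (heat bath, Metropolis, Metropolis-corrected flow proposals …), `K ≥ 1`, summable level
autocorrelations with `ρ(1) < 1` (row 8's provisos): `K(K+2)/(6ā_K) − ½ ≤ τ_int(level)`. [ours] -/
theorem stMix_level_tauInt_ge (hXm : Measurable X) (hXb : ∃ C, ∀ x, |X x| ≤ C) (hK : 1 ≤ K) (t : unitInterval)
    (M : Fin (K + 1) → Kernel Ω Ω) [∀ k, IsMarkovKernel (M k)]
    (hM : ∀ k : Fin (K + 1), Kernel.IsReversible (M k) (μ.tilted fun x => β k * X x))
    (hs : Summable fun n => autocov (mixtureKernel t (stLevelKernel hXm μ β K) (stWithinLevel M)) (stTarget X μ β K)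
        (fun z => (((z.1 : Fin (K + 1)) : ℕ) : ℝ) - K / 2) (n + 1) /
      autocov (mixtureKernel t (stLevelKernel hXm μ β K) (stWithinLevel M)) (stTarget X μ β K)
        (fun z => (((z.1 : Fin (K + 1)) : ℕ) : ℝ) - K / 2) 0)
    (hρ : autocov (mixtureKernel t (stLevelKernel hXm μ β K) (stWithinLevel M)) (stTarget X μ β K)
        (fun z => (((z.1 : Fin (K + 1)) : ℕ) : ℝ) - K / 2) 1 /
      autocov (mixtureKernel t (stLevelKernel hXm μ β K) (stWithinLevel M)) (stTarget X μ β K)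
        (fun z => (((z.1 : Fin (K + 1)) : ℕ) : ℝ) - K / 2) 0 < 1) :
    K * (K + 2) / (6 * (2 / (K + 1) * ∑ k ∈ range K, ∫ x, min (Real.exp (β k * X x) / mgf X μ (β k))
        (Real.exp (β (k + 1) * X x) / mgf X μ (β (k + 1))) ∂μ)) - 1 / 2 ≤
      tauInt (fun n => autocov (mixtureKernel t (stLevelKernel hXm μ β K) (stWithinLevel M)) (stTarget X μ β K)
          (fun z => (((z.1 : Fin (K + 1)) : ℕ) : ℝ) - K / 2) n /
        autocov (mixtureKernel t (stLevelKernel hXm μ β K) (stWithinLevel M)) (stTarget X μ β K)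
          (fun z => (((z.1 : Fin (K + 1)) : ℕ) : ℝ) - K / 2) 0) :=
  st_level_tauInt_ge hXm hXb hK _ (stMix_isReversible hXm hXb t M hM)
    (stMix_invariant hXm hXb t M fun k => (hM k).invariant) (stMix_nearestNeighbour hXm t M)
    (stMix_rate_le hXm t M) hs hρ

/-- **`τ_int` OF THE LEVEL, LADDER-SIZE-FREE (random scan, reversible within-level updates)**: uniform ladder on
`[a, b]`, variance floor `0 < m ≤ Var_{μ_u}(X)`: `e·m·(b−a)²/96 − ½ ≤ τ_int(level)` for every `K ≥ 1` and every
`t` — the integrated autocorrelation time of the coupling index is at least of order heat capacity × window².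
[ours] -/
theorem stMix_level_tauInt_ge_kfree (hXm : Measurable X) (hXb : ∃ C, ∀ x, |X x| ≤ C) {a b m : ℝ} (hab : a < b)
    (hm0 : 0 < m) (hm : ∀ u ∈ Icc a b, m ≤ variance X (μ.tilted fun x => u * X x)) (hK : 1 ≤ K)
    (t : unitInterval) (M : Fin (K + 1) → Kernel Ω Ω) [∀ k, IsMarkovKernel (M k)]
    (hM : ∀ k : Fin (K + 1), Kernel.IsReversible (M k) (μ.tilted fun x => (a + k * ((b - a) / K)) * X x))
    (hs : Summable fun n =>
      autocov (mixtureKernel t (stLevelKernel hXm μ (fun k => a + k * ((b - a) / K)) K) (stWithinLevel M))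
        (stTarget X μ (fun k => a + k * ((b - a) / K)) K) (fun z => (((z.1 : Fin (K + 1)) : ℕ) : ℝ) - K / 2) (n + 1) /
      autocov (mixtureKernel t (stLevelKernel hXm μ (fun k => a + k * ((b - a) / K)) K) (stWithinLevel M))
        (stTarget X μ (fun k => a + k * ((b - a) / K)) K) (fun z => (((z.1 : Fin (K + 1)) : ℕ) : ℝ) - K / 2) 0)
    (hρ : autocov (mixtureKernel t (stLevelKernel hXm μ (fun k => a + k * ((b - a) / K)) K) (stWithinLevel M))
        (stTarget X μ (fun k => a + k * ((b - a) / K)) K) (fun z => (((z.1 : Fin (K + 1)) : ℕ) : ℝ) - K / 2) 1 /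
      autocov (mixtureKernel t (stLevelKernel hXm μ (fun k => a + k * ((b - a) / K)) K) (stWithinLevel M))
        (stTarget X μ (fun k => a + k * ((b - a) / K)) K) (fun z => (((z.1 : Fin (K + 1)) : ℕ) : ℝ) - K / 2) 0 < 1) :
    Real.exp 1 * m * (b - a) ^ 2 / 96 - 1 / 2 ≤
      tauInt (fun n =>
        autocov (mixtureKernel t (stLevelKernel hXm μ (fun k => a + k * ((b - a) / K)) K) (stWithinLevel M))
          (stTarget X μ (fun k => a + k * ((b - a) / K)) K) (fun z => (((z.1 : Fin (K + 1)) : ℕ) : ℝ) - K / 2) n /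
        autocov (mixtureKernel t (stLevelKernel hXm μ (fun k => a + k * ((b - a) / K)) K) (stWithinLevel M))
          (stTarget X μ (fun k => a + k * ((b - a) / K)) K) (fun z => (((z.1 : Fin (K + 1)) : ℕ) : ℝ) - K / 2) 0) :=
  st_level_tauInt_ge_kfree hXm hXb hab hm0 hm hK _ (stMix_isReversible hXm hXb t M hM)
    (stMix_invariant hXm hXb t M fun k => (hM k).invariant) (stMix_nearestNeighbour hXm t M)
    (stMix_rate_le hXm t M) hs hρ

end Mix

end Summit.Ventures.LatticeQCDFlow.Scaling

end
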